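/-
Copyright (c) 2026 the pub-hodgecm-mathlib formalisation cell (harness21).  Prover seat hodgecm-mathlib-LH4-p10 (g6): Track A «(D-RAM) FOUR-FRAME» squad of crux H413, (β) TABLE —
dealer LH4-plan (g13) WORD #124 ∕ sub-dealer LH4-p05 (g8) β-BOARD v1 row R2 (P2b) «THE G₃ PURE SUM FILE»; recipe LH4-p11 (g8) `stageB/VERDICT-G3row.v1` b6c59e93 §(P2b).  2026-09-04.
-/
import Summits.HodgeConjecture.HodgeConjecture.Theorems.F0P3cDyRamLabelledOddPureStrataG2   -- ★ p860856 (LH4-p11): the G₂ template; brings ★ G₁ FILE 2b, ★ κ-rotations `…hasAxis_G3`, ★ §P `…_G3_of_G1`, ★ B56, the DEFS leaves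
import HarnessLib

/-!
# Crux `H413`, line LH4 «(D-RAM) FOUR-FRAME» — (β-BAL) Stage B, THE PURE STRATA: the GLUED strata `G₃ = (2ρ+s, 2ρ+s, 2ρ)` in the one-slot cell `2ρ + m* ≤ n₁`,
# THE SUM FILE (P2b): `Σᶠ_{M ∈ stratum G₃, clean shell} labelledOddCount σ ϖ 0 i Λ M ∕ [𝒰 : N(S̃′(M))]` FROM THE PER-LATTICE READ AND THE ★ G₃ SOCKETS

Cell `hodgecm-mathlib` (D-0151), FLOOR 0, crux item H413 = `stmt-HodgeConjecture-24833`, route `HCCMUnconditional`; squad F0∕P3c∕LH4.  THEOREMS ONLY (no `def`, no instance, no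
notation, no `sorry`, default heartbeats); ★-only imports; lane `--supports stmt-HodgeConjecture-24833 --as helper` (count-neutral); pays NO row, states NO law.
WHAT.  Row R2 of LH4-p05 (g8)'s β-BOARD v1 in the board's COMMON SHAPE, split per LH4-p11 (g8)'s VERDICT-G3row.v1 (b6c59e93): the per-lattice inputs — (i) the clean-shell READ on
the stratum (`hshell`: the three shell tokens of `X = diag(α−1, β−1, 0)` hold iff `2ρ + s + ℓ₀ = n₃`; LH7-p06 (g0)'s `shell_iff_of_mem_stratum_G3` over ★ p861251), (ii) the TUBE
letters on that read (`htube`: `2 ∣ s`, `2ρ ≤ n₁`, `2ρ ≤ n₂`; `two_dvd_of_mem_stratum_G3` ∕ `tube_of_mem_stratum_G3`) and (iii) the POINTWISE VALUE ((P2a), LH4-p11 (g9)'s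
`labelledOddCount_div_relIndex_of_mem_stratum_G3`: `value_i(M) = ω(−1)·ω(e_C)∕2 · (1, κ₂(M), κ₁(M))_i · stabiliserWeight σ M`, token `e_C` of `β − α`) — enter as three ∀-HYPOTHESIS
binders in their announced head shapes and are discharged BY NAME when those files land; THIS FILE does the sum: ★ `finsum_mem_sep_eq_ite_of_forall_iff` cuts the shell onto the
read, then slot 0 = the orbit mass ★ §P `finsum_stabiliserWeight_stratum_G3_of_G1` ∘ ★ B56 `finsum_stabiliserWeight_hasAxis_G1`, slots 1∕2 = the κ₂∕κ₁-weighted G₃ sockets ★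
`finsum_kappaCount_mul_stabiliserWeight_hasAxis_G3` (glue branch void in the cell), giving the PURE COLUMN
`[2ρ + s + ℓ₀ = n₃ ∧ 2 ∣ s ∧ 2ρ ≤ min n₁ n₂] · ω(e_C)∕2 · (ω(−1)(q−1)q^e, q^e((q−1)[2d ≤ s] − [s+2 = 2d]), 0)_i`, `e = 2ρ + s∕2 − 1` (VERDICT §2 = LH4-p08 (g9)'s (P2) fit in the cell),
plus the TOKEN-FREE `_eq_zero_of_not` twin (value `0` off the read, from `hshell` + `htube` alone).
HONEST LABEL.  Count-neutral; conditional on (P2a) + the G₃ shell read until they are ★; (β)∕table∕T₊ OPEN; `HC_CM` is proved only modulo the 7 printed citations (2 remaining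
named inputs: hLiu418 = `stmt-HodgeConjecture-24832`, h413 = `stmt-HodgeConjecture-24833`) until rung 0 closes.
References: [Kottwitz1986BaseChangeUnits] §1 pp. 240–241 · [Rogawski1990] §4.9 Prop. 4.9.1 (a)(b) p. 55, §4.10 p. 58 · [LanglandsShelstad1987] §3.
-/

set_option autoImplicit false

noncomputable section

namespace Summit.HodgeConjecture.HodgeConjecture.Cruxes.H413.F0P3cDyRamLabelledOddPureStrataG3

open Matrix WithZero
open Literature.NumberTheory.Automorphic Literature.NumberTheory.Automorphic.HermitianLattice
open Literature.NumberTheory.Automorphic.UnitaryLatticeTree Literature.NumberTheory.Automorphic.UnitaryThreeFourFrame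
open Literature.NumberTheory.LocalFields Literature.NumberTheory.LocalFields.WildQuadraticDatum
open Summit.HodgeConjecture.HodgeConjecture.Cruxes.H413.F0P3cDyRamFourFramePieces
open Summit.HodgeConjecture.HodgeConjecture.Cruxes.H413.F0P3cDyRamFourFrameCensusDefs
open Summit.HodgeConjecture.HodgeConjecture.Cruxes.H413.F0P3cDyRamStageOneBDefs (mcOfRecord)
open Summit.HodgeConjecture.HodgeConjecture.Cruxes.H413.F0P3cDyRamDiagonalTorusDefs
open Summit.HodgeConjecture.HodgeConjecture.Cruxes.H413.F0P3cDyRamDiagonalStrataDefs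
open Summit.HodgeConjecture.HodgeConjecture.Cruxes.H413.F0P3cDyRamDiagonalKappaCountDefs
open Summit.HodgeConjecture.HodgeConjecture.Cruxes.H413.F0P3cDyRamLabelledOddCountDefs
open Summit.HodgeConjecture.HodgeConjecture.Cruxes.H413.F0P3cDyRamDiagonalPermutation
open Summit.HodgeConjecture.HodgeConjecture.Cruxes.H413.F0P3cDyRamDiagonalKappaGluedRotations (finsum_kappaCount_mul_stabiliserWeight_hasAxis_G3)
open Summit.HodgeConjecture.HodgeConjecture.Cruxes.H413.F0P3cDyRamDiagonalGluedSocket (finsum_stabiliserWeight_hasAxis_G1)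
open Summit.HodgeConjecture.HodgeConjecture.Cruxes.H413.F0P3cDyRamLabelledSplitStrata (finsum_mem_sep_eq_ite_of_forall_iff)
open scoped Valued WithZero Matrix MatrixGroups

variable {K : Type} [Field K] [Valued K ℤᵐ⁰]


section Strata

variable [CompleteSpace K] [Fintype 𝓀[K]] {σ : K →+* K} {ϖ : K} {d t : ℕ} {α β : K} {N₀ n₁ n₂ n₃ : ℕ}

omit [CompleteSpace K] [Fintype 𝓀[K]] in
/-- **`G₃` OFF THE READ, TOKEN-FREE**: given the clean-shell read `hshell` and the tube letters `htube` on the stratum `(2ρ+s, 2ρ+s, 2ρ)`, if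
`¬ (2ρ + s + ℓ₀ = n₃ ∧ 2 ∣ s ∧ 2ρ ≤ min n₁ n₂)` the clean-shell cut of the stratum carries labelled odd value `0` in every slot (for ANY label `Λ` and ANY weight).
[cite: Kottwitz1986BaseChangeUnits, §1 pp. 240–241] [cite: Rogawski1990, §4.9 Prop. 4.9.1 (a) p. 55] -/
theorem finsum_stratum_G3_shell_eq_zero_of_not (T : GL (Fin 3) K) (ρ s : ℕ)
    (Λ : Submodule 𝒪[K] (Fin 3 → K) → (Fin 3 → K) → Prop) (w : Submodule 𝒪[K] (Fin 3 → K) → ℚ)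
    (hshell : ∀ M ∈ stratum σ ϖ T ![2 * ρ + s, 2 * ρ + s, 2 * ρ],
      (LatticeInLevel ϖ (d % 2) (Matrix.diagonal ![α - 1, β - 1, 0]) M ∧ ¬ LatticeInLevel ϖ (d % 2 + 1) (Matrix.diagonal ![α - 1, β - 1, 0]) M ∧
          LatticeInLevel ϖ (mcOfRecord d) (Matrix.diagonal ![(α - 1) * (α - 1), (β - 1) * (β - 1), 0]) M) ↔ 2 * ρ + s + d % 2 = n₃)
    (htube : ∀ M ∈ stratum σ ϖ T ![2 * ρ + s, 2 * ρ + s, 2 * ρ], 2 * ρ + s + d % 2 = n₃ → 2 ∣ s ∧ 2 * ρ ≤ n₁ ∧ 2 * ρ ≤ n₂)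
    (hnot : ¬ (2 * ρ + s + d % 2 = n₃ ∧ 2 ∣ s ∧ 2 * ρ ≤ min n₁ n₂)) (i : Fin 3) :
    ∑ᶠ M ∈ {M : Submodule 𝒪[K] (Fin 3 → K) | M ∈ stratum σ ϖ T ![2 * ρ + s, 2 * ρ + s, 2 * ρ] ∧
        (LatticeInLevel ϖ (d % 2) (Matrix.diagonal ![α - 1, β - 1, 0]) M ∧ ¬ LatticeInLevel ϖ (d % 2 + 1) (Matrix.diagonal ![α - 1, β - 1, 0]) M ∧
          LatticeInLevel ϖ (mcOfRecord d) (Matrix.diagonal ![(α - 1) * (α - 1), (β - 1) * (β - 1), 0]) M)},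
      (labelledOddCount σ ϖ 0 i Λ M : ℚ) / w M = 0 := by
  classical
  rw [finsum_mem_sep_eq_ite_of_forall_iff (stratum σ ϖ T ![2 * ρ + s, 2 * ρ + s, 2 * ρ]) _ _ hshell]
  by_cases hP : 2 * ρ + s + d % 2 = n₃
  · rw [if_pos hP]
    have hzero : ∀ M ∈ stratum σ ϖ T ![2 * ρ + s, 2 * ρ + s, 2 * ρ], (labelledOddCount σ ϖ 0 i Λ M : ℚ) / w M = 0 := by
      intro M hM
      obtain ⟨h2s, h1, h2⟩ := htube M hM hP
      exact absurd ⟨hP, h2s, le_min h1 h2⟩ hnot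
    rw [finsum_mem_congr rfl hzero]
    simp
  · rw [if_neg hP]

/-- **THE `G₃ = (2ρ+s, 2ρ+s, 2ρ)` STRATUM ON THE CLEAN SHELL, ONE-SLOT CELL `2ρ + m* ≤ n₁` — THE SUM** (`ρ, s ≥ 1`; `d ≤ N₀`; `|2| < 1`; token `e_C` of `β − α` inside the read):
from the per-lattice READ `hval` (= (P2a): `value_i(M) = ω(−1)ω(e_C)∕2·(1, κ₂(M), κ₁(M))_i·stabiliserWeight σ M` on the shell), the clean-shell iff `hshell` and the tube letters `htube`,
`Σᶠ_{M ∈ stratum G₃, shell} value_i(M) = [2ρ + s + ℓ₀ = n₃ ∧ 2 ∣ s ∧ 2ρ ≤ min n₁ n₂] · ω(e_C)∕2 · (ω(−1)·(q−1)·q^{2ρ+s∕2−1}, q^{2ρ+s∕2−1}·((q−1)·[2d ≤ s] − [s+2 = 2d]), 0)_i`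
— slot 0 the orbit mass (★ §P `…_G3_of_G1` ∘ ★ B56), slots 1∕2 the ★ κ₂∕κ₁-weighted G₃ sockets (glue branch void in the cell).
[cite: Kottwitz1986BaseChangeUnits, §1 pp. 240–241] [cite: Rogawski1990, §4.9 Prop. 4.9.1 (a)(b) p. 55, §4.10 p. 58] [cite: LanglandsShelstad1987, §3] -/
theorem finsum_stratum_G3_shell_labelledOdd_div_relIndex_eq (hD : IsRamifiedQuadraticDatum σ ϖ d t) (h2 : Valued.v (2 : K) < 1)
    (hE : IsElementDatum σ ϖ N₀ α β n₁ n₂ n₃) (hN₀ : d ≤ N₀)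
    (T : GL (Fin 3) K) (hT : (T : Matrix (Fin 3) (Fin 3) K) = Matrix.diagonal ![α, β, 1]) (ρ s : ℕ) (hρ : 1 ≤ ρ) (hs : 1 ≤ s)
    (hcell : 2 * ρ + mstarOfRecord d ≤ n₁) {eC : K}
    (hshell : ∀ M ∈ stratum σ ϖ T ![2 * ρ + s, 2 * ρ + s, 2 * ρ],
      (LatticeInLevel ϖ (d % 2) (Matrix.diagonal ![α - 1, β - 1, 0]) M ∧ ¬ LatticeInLevel ϖ (d % 2 + 1) (Matrix.diagonal ![α - 1, β - 1, 0]) M ∧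
          LatticeInLevel ϖ (mcOfRecord d) (Matrix.diagonal ![(α - 1) * (α - 1), (β - 1) * (β - 1), 0]) M) ↔ 2 * ρ + s + d % 2 = n₃)
    (htube : ∀ M ∈ stratum σ ϖ T ![2 * ρ + s, 2 * ρ + s, 2 * ρ], 2 * ρ + s + d % 2 = n₃ → 2 ∣ s ∧ 2 * ρ ≤ n₁ ∧ 2 * ρ ≤ n₂) (i : Fin 3)
    (hval : ∀ M ∈ stratum σ ϖ T ![2 * ρ + s, 2 * ρ + s, 2 * ρ],
      (LatticeInLevel ϖ (d % 2) (Matrix.diagonal ![α - 1, β - 1, 0]) M ∧ ¬ LatticeInLevel ϖ (d % 2 + 1) (Matrix.diagonal ![α - 1, β - 1, 0]) M ∧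
          LatticeInLevel ϖ (mcOfRecord d) (Matrix.diagonal ![(α - 1) * (α - 1), (β - 1) * (β - 1), 0]) M) →
      (labelledOddCount σ ϖ 0 i (valueClassLabel σ ϖ (α - 1) (β - 1) (mstarOfRecord d) d) M : ℚ) /
          ((((unitStabilizer M).map (unitNormMap σ 3)).relIndex (fixedUnitTorus σ 3) : ℕ) : ℚ) =
        (normSign σ (-1 : K) * normSign σ eC : ℚ) / 2 * ((((![1, kappaCount σ ϖ 0 2 M, kappaCount σ ϖ 0 1 M] : Fin 3 → ℤ) i) : ℤ) : ℚ) * stabiliserWeight σ M) :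
    ∑ᶠ M ∈ {M : Submodule 𝒪[K] (Fin 3 → K) | M ∈ stratum σ ϖ T ![2 * ρ + s, 2 * ρ + s, 2 * ρ] ∧
        (LatticeInLevel ϖ (d % 2) (Matrix.diagonal ![α - 1, β - 1, 0]) M ∧ ¬ LatticeInLevel ϖ (d % 2 + 1) (Matrix.diagonal ![α - 1, β - 1, 0]) M ∧
          LatticeInLevel ϖ (mcOfRecord d) (Matrix.diagonal ![(α - 1) * (α - 1), (β - 1) * (β - 1), 0]) M)},
      (labelledOddCount σ ϖ 0 i (valueClassLabel σ ϖ (α - 1) (β - 1) (mstarOfRecord d) d) M : ℚ) /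
        ((((unitStabilizer M).map (unitNormMap σ 3)).relIndex (fixedUnitTorus σ 3) : ℕ) : ℚ) =
      if 2 * ρ + s + d % 2 = n₃ ∧ 2 ∣ s ∧ 2 * ρ ≤ min n₁ n₂ then
        (normSign σ eC : ℚ) / 2 *
          (![(normSign σ (-1 : K) : ℚ) * ((Fintype.card 𝓀[K] : ℚ) - 1) * (Fintype.card 𝓀[K] : ℚ) ^ (2 * ρ + s / 2 - 1),
              (Fintype.card 𝓀[K] : ℚ) ^ (2 * ρ + s / 2 - 1) * ((if 2 * d ≤ s then (Fintype.card 𝓀[K] : ℚ) - 1 else 0) - (if s + 2 = 2 * d then 1 else 0)),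
              (0 : ℚ)] : Fin 3 → ℚ) i
      else 0 := by
  classical
  have hmsv : mstarOfRecord d = d % 2 + 2 * d - 1 := rfl
  have hωm : (normSign σ (-1 : K) : ℚ) * (normSign σ (-1 : K) : ℚ) = 1 := by
    unfold normSign; split_ifs <;> norm_num
  by_cases hcond : 2 * ρ + s + d % 2 = n₃ ∧ 2 ∣ s ∧ 2 * ρ ≤ min n₁ n₂
  swap
  · rw [if_neg hcond]
    exact finsum_stratum_G3_shell_eq_zero_of_not T ρ s _ _ hshell htube hcond i
  obtain ⟨hP, ⟨j', hj'⟩, hc⟩ := hcond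
  rw [if_pos ⟨hP, Dvd.intro j' hj'.symm, hc⟩, finsum_mem_sep_eq_ite_of_forall_iff (stratum σ ϖ T ![2 * ρ + s, 2 * ρ + s, 2 * ρ]) _ _ hshell, if_pos hP]
  -- pointwise: the READ on every member (the shell holds on the whole stratum by `hshell` and `hP`)
  have hval' : ∀ M ∈ stratum σ ϖ T ![2 * ρ + s, 2 * ρ + s, 2 * ρ],
      (labelledOddCount σ ϖ 0 i (valueClassLabel σ ϖ (α - 1) (β - 1) (mstarOfRecord d) d) M : ℚ) /
          ((((unitStabilizer M).map (unitNormMap σ 3)).relIndex (fixedUnitTorus σ 3) : ℕ) : ℚ) =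
        (normSign σ (-1 : K) * normSign σ eC : ℚ) / 2 * ((((![1, kappaCount σ ϖ 0 2 M, kappaCount σ ϖ 0 1 M] : Fin 3 → ℤ) i) : ℤ) : ℚ) * stabiliserWeight σ M :=
    fun M hM => hval M hM ((hshell M hM).2 hP)
  rw [finsum_mem_congr rfl hval']
  -- the sockets: glue branch void in the cell (`n₂ = n₁ ≥ 2ρ + m* > 2ρ`)
  have hcell' := hcell
  rw [hmsv] at hcell'
  have hglue : 2 ∣ s → n₂ = n₁ → n₃ = n₂ + s → n₂ < 2 * ρ → 2 * ρ - n₂ ≤ n₂ - d + 1 → Valued.v ((0 : K) + (β - α) / (1 - α)) ≤ Valued.v ϖ ^ (2 * ρ + s - n₂) :=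
    fun _ h2 _ h4 _ => by omega
  have hng : ¬ (2 ∣ s ∧ n₂ = n₁ ∧ n₃ = n₂ + s ∧ n₂ < 2 * ρ ∧ 2 * ρ - n₂ ≤ n₂ - d + 1) := fun h => by omega
  have hκ1 := finsum_kappaCount_mul_stabiliserWeight_hasAxis_G3 hD h2 hE hN₀ hT ρ s hρ hs 1 0 (map_zero σ) hglue
  have hκ2 := finsum_kappaCount_mul_stabiliserWeight_hasAxis_G3 hD h2 hE hN₀ hT ρ s hρ hs 2 0 (map_zero σ) hglue
  rw [if_neg hng, add_zero] at hκ1 hκ2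
  have hsw := finsum_stabiliserWeight_stratum_G3_of_G1 hD.2.1 hE hT ρ s
    (fun m₁ m₂ m₃ => (if 2 ∣ s ∧ 2 * ρ ≤ min m₂ m₃ ∧ 2 * ρ + s ≤ m₁ then (((Fintype.card 𝓀[K] : ℚ) - 1) * (Fintype.card 𝓀[K] : ℚ) ^ (2 * ρ + s / 2 - 1)) else 0) +
      (if 2 ∣ s ∧ m₂ = m₃ ∧ m₁ = m₂ + s ∧ m₂ < 2 * ρ ∧ 2 * ρ - m₂ ≤ m₂ - d + 1
        then ((Fintype.card 𝓀[K] : ℚ) ^ (2 * ρ + s / 2 - (2 * ρ - m₂ + 1) / 2)) else 0))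
    (fun T' hE'' hT' => finsum_stabiliserWeight_hasAxis_G1 hD h2 hE'' hN₀ hT' ρ s hρ hs)
  have hng' : ¬ (2 ∣ s ∧ n₂ = n₁ ∧ n₃ = n₂ + s ∧ n₂ < 2 * ρ ∧ 2 * ρ - n₂ ≤ n₂ - d + 1) := hng
  simp only [hng', if_false, add_zero] at hsw
  have e2s : s / 2 = j' := by omega
  have hside : 2 ∣ s ∧ 2 * ρ ≤ min n₂ n₁ ∧ 2 * ρ + s ≤ n₃ := ⟨Dvd.intro j' hj'.symm, by rw [min_comm]; exact hc, by omega⟩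
  by_cases hi0 : i = 0
  · -- slot `0`: the plain orbit count
    subst hi0
    have hpt : ∀ M ∈ stratum σ ϖ T ![2 * ρ + s, 2 * ρ + s, 2 * ρ],
        (normSign σ (-1 : K) * normSign σ eC : ℚ) / 2 * ((((![1, kappaCount σ ϖ 0 2 M, kappaCount σ ϖ 0 1 M] : Fin 3 → ℤ) 0) : ℤ) : ℚ) * stabiliserWeight σ M =
          (normSign σ (-1 : K) * normSign σ eC : ℚ) / 2 * stabiliserWeight σ M := fun M _ => by
      simp only [Matrix.cons_val_zero]; push_cast; ring
    rw [finsum_mem_congr rfl hpt, ← mul_finsum_mem, hsw, if_pos hside]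
    simp only [Matrix.cons_val_zero]
    ring
  by_cases hi1 : i = 1
  · -- slot `1`: the `κ₂`-weighted G3 socket
    subst hi1
    have hpt : ∀ M ∈ stratum σ ϖ T ![2 * ρ + s, 2 * ρ + s, 2 * ρ],
        (normSign σ (-1 : K) * normSign σ eC : ℚ) / 2 * ((((![1, kappaCount σ ϖ 0 2 M, kappaCount σ ϖ 0 1 M] : Fin 3 → ℤ) 1) : ℤ) : ℚ) * stabiliserWeight σ M =
          (normSign σ (-1 : K) * normSign σ eC : ℚ) / 2 * ((kappaCount σ ϖ 0 2 M : ℚ) * stabiliserWeight σ M) := fun M _ => by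
      simp only [Matrix.cons_val_one, Matrix.cons_val_zero]; ring
    rw [finsum_mem_congr rfl hpt, ← mul_finsum_mem, hκ2, if_pos hside]
    simp only [Matrix.cons_val_two, Matrix.tail_cons, Matrix.head_cons, Matrix.cons_val_one, Matrix.cons_val_zero]
    linear_combination ((normSign σ eC : ℚ) / 2 * (Fintype.card 𝓀[K] : ℚ) ^ (2 * ρ + s / 2 - 1) *
      ((if 2 * d ≤ s then (Fintype.card 𝓀[K] : ℚ) - 1 else 0) - (if s + 2 = 2 * d then 1 else 0))) * hωm
  · -- slot `2`: the `κ₁`-weighted G3 socket vanishes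
    obtain rfl : i = 2 := by
      fin_cases i
      · exact absurd rfl hi0
      · exact absurd rfl hi1
      · rfl
    have hpt : ∀ M ∈ stratum σ ϖ T ![2 * ρ + s, 2 * ρ + s, 2 * ρ],
        (normSign σ (-1 : K) * normSign σ eC : ℚ) / 2 * ((((![1, kappaCount σ ϖ 0 2 M, kappaCount σ ϖ 0 1 M] : Fin 3 → ℤ) 2) : ℤ) : ℚ) * stabiliserWeight σ M =
          (normSign σ (-1 : K) * normSign σ eC : ℚ) / 2 * ((kappaCount σ ϖ 0 1 M : ℚ) * stabiliserWeight σ M) := fun M _ => by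
      simp only [Matrix.cons_val_two, Matrix.tail_cons, Matrix.head_cons]; ring
    rw [finsum_mem_congr rfl hpt, ← mul_finsum_mem, hκ1, if_pos hside]
    simp

end Strata

end Summit.HodgeConjecture.HodgeConjecture.Cruxes.H413.F0P3cDyRamLabelledOddPureStrataG3

end
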